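import Literature.Probability.RandomPlanarGeometry.HexSAWPolygonCellsBoundary
import Literature.Barriers.CriticalPhenomena.SupercriticalSAWSpaceFillingBoxesRungs
import HarnessLib

/-!
# Cell calculus for honeycomb polygon surgery, XXI: TRANSLATIONS of sets of hexagons (`bdry (S + z) = bdry S + z`) and the bottom-left hexagon

Topic `Literature/Probability/RandomPlanarGeometry` (lane «pcv-sawmu», a-p4 g22; sequel of `HexSAWPolygonCellsBoundary.lean` (XVII: `bond`, `bdry`);
uses the tree's edge-set translation `shiftEdges` (`Barriers/CriticalPhenomena/SupercriticalSAWSpaceFillingBoxesRungs.lean`)).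

Fifth module of the BRIDGE between the cell layer of «OMEGA» and the tree's bond-set polygons: the translation bookkeeping needed to pass from
`q_N(ℍ)` = polygons up to translation (`PolygonConcat.canonEnd`, `exists_canonEnd_of_isPolygon`, `eq_of_shiftEdges_brickLoopEdges_of_mem_canonEnd`)
to sets of hexagons.  `shiftCell z c = c + z` (an EVEN `z` keeps bricks bricks), `bond_shiftCell`, ★ `bdry_image_shiftCell :
bdry (S.image (shiftCell z)) = shiftEdges z (bdry S)`, `perim_image_shiftCell`; and the BOTTOM-LEFT hexagon `IsLexmin S b` (lowest row, then leftmost —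
the order dual to `IsLexmax`), its existence and uniqueness, and `isLexmin_image_shiftCell`.  (The step-two injection of the sequel is applied to
sets normalised by `IsLexmin S (0, 0)`, which it preserves.)

Sources: N. Madras, G. Slade, *The Self-Avoiding Walk* (1993), §3.2, Definition 3.2.2 and eq. (3.2.1) p. 63 (polygons counted up to translation; one
representative per class) [MadrasSlade1993]; I. G. Enting, I. Jensen, LNP 775 (2009) §7.4.2, Fig. 7.10 (the brick wall has two sites per fundamental
domain: translations by even vectors) [EntingJensen2009]; I. Jensen, J. Phys.: Conf. Ser. 42 (2006) 163 [Jensen2006HoneycombPolygons].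
Label (lane): LANE INFRASTRUCTURE; nothing new in writing.
-/

open Finset Literature.Probability.LatticeModels
open Literature.Barriers.CriticalPhenomena.SupercriticalSAW (shiftEdges mem_shiftEdges_iff)

namespace Literature.Probability.RandomPlanarGeometry.SAW

namespace HexCell

/-! ### Translating hexagons -/

/-- The hexagon `c` translated by `z ∈ ℤ²`. [cite: MadrasSlade1993, Definition 3.2.2 p. 63 (translation classes)] -/
def shiftCell (z : Site 2) (c : Cell) : Cell := (c.1 + z 0, c.2 + z 1)

/-- Coordinates of a translated hexagon. [cite: MadrasSlade1993, Definition 3.2.2 p. 63] -/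
@[simp] theorem shiftCell_fst (z : Site 2) (c : Cell) : (shiftCell z c).1 = c.1 + z 0 := rfl

/-- Coordinates of a translated hexagon. [cite: MadrasSlade1993, Definition 3.2.2 p. 63] -/
@[simp] theorem shiftCell_snd (z : Site 2) (c : Cell) : (shiftCell z c).2 = c.2 + z 1 := rfl

/-- Translation by `0`. [cite: MadrasSlade1993, Definition 3.2.2 p. 63] -/
@[simp] theorem shiftCell_zero (c : Cell) : shiftCell 0 c = c := by ext <;> simp

/-- Translations compose. [cite: MadrasSlade1993, Definition 3.2.2 p. 63] -/
theorem shiftCell_shiftCell (z w : Site 2) (c : Cell) : shiftCell z (shiftCell w c) = shiftCell (z + w) c :=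
  Prod.ext (by show c.1 + w 0 + z 0 = c.1 + (z + w) 0; rw [Pi.add_apply]; ring)
    (by show c.2 + w 1 + z 1 = c.2 + (z + w) 1; rw [Pi.add_apply]; ring)

/-- Translation is injective. [cite: MadrasSlade1993, Definition 3.2.2 p. 63] -/
theorem shiftCell_injective (z : Site 2) : Function.Injective (shiftCell z) := by
  intro c d h
  simp only [shiftCell, Prod.mk.injEq] at h
  ext <;> omega

/-- Translating twice. [cite: MadrasSlade1993, Definition 3.2.2 p. 63] -/
theorem image_shiftCell_image (z w : Site 2) (S : Finset Cell) : (S.image (shiftCell w)).image (shiftCell z) = S.image (shiftCell (z + w)) := by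
  rw [image_image]; congr 1; funext c; exact shiftCell_shiftCell z w c

/-- Translating by `0`. [cite: MadrasSlade1993, Definition 3.2.2 p. 63] -/
@[simp] theorem image_shiftCell_zero (S : Finset Cell) : S.image (shiftCell 0) = S := by
  conv_rhs => rw [← image_id (s := S)]
  congr 1; funext c; exact shiftCell_zero c

/-- An EVEN translation maps bricks to bricks. [cite: EntingJensen2009, §7.4.2, Fig. 7.10 (two sites per fundamental domain)] -/
theorem even_shiftCell {z : Site 2} (hz : Even (z 0 + z 1)) {c : Cell} (hc : Even (c.1 + c.2)) :
    Even ((shiftCell z c).1 + (shiftCell z c).2) := by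
  simp only [shiftCell_fst, shiftCell_snd]
  have : c.1 + z 0 + (c.2 + z 1) = (c.1 + c.2) + (z 0 + z 1) := by ring
  rw [this]; exact hc.add hz

/-- An even translate of a brick set is a brick set. [cite: EntingJensen2009, §7.4.2, Fig. 7.10] -/
theorem isBrickSet_image_shiftCell {z : Site 2} (hz : Even (z 0 + z 1)) {S : Finset Cell} (hS : IsBrickSet S) :
    IsBrickSet (S.image (shiftCell z)) := by
  intro c hc
  obtain ⟨d, hd, rfl⟩ := mem_image.1 hc
  exact even_shiftCell hz (hS d hd)

/-- Neighbourhood is translation invariant. [cite: Jensen2006HoneycombPolygons, §2] -/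
theorem shiftCell_mem_nbrs_iff (z : Site 2) {c d : Cell} : shiftCell z d ∈ nbrs (shiftCell z c) ↔ d ∈ nbrs c := by
  obtain ⟨x, y⟩ := c
  obtain ⟨x', y'⟩ := d
  simp only [mem_nbrs_iff, shiftCell, Prod.mk.injEq]
  omega

/-- The neighbours of a translate. [cite: Jensen2006HoneycombPolygons, §2] -/
theorem nbrs_shiftCell (z : Site 2) (c : Cell) : nbrs (shiftCell z c) = (nbrs c).image (shiftCell z) := by
  ext d
  rw [mem_image]
  constructor
  · intro hd
    refine ⟨shiftCell (-z) d, ?_, ?_⟩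
    · rw [← shiftCell_mem_nbrs_iff z, shiftCell_shiftCell, add_neg_cancel, shiftCell_zero]; exact hd
    · rw [shiftCell_shiftCell, add_neg_cancel, shiftCell_zero]
  · rintro ⟨d', hd', rfl⟩; exact (shiftCell_mem_nbrs_iff z).2 hd'

/-! ### Translating bonds and boundaries -/

/-- Translating a horizontal bond. [cite: EntingJensen2009, §7.4.2, Fig. 7.10] -/
theorem map_hbond (z : Site 2) (a h : ℤ) : Sym2.map (fun v => v + z) (hbond a h) = hbond (a + z 0) (h + z 1) := by
  rw [hbond, hbond, Sym2.map_mk, Sym2.eq_iff]; left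
  refine ⟨?_, ?_⟩
  · rw [site_two_eq_iff]; simp
  · rw [site_two_eq_iff]; simp; ring

/-- Translating a vertical bond. [cite: EntingJensen2009, §7.4.2, Fig. 7.10] -/
theorem map_vbond (z : Site 2) (a h : ℤ) : Sym2.map (fun v => v + z) (vbond a h) = vbond (a + z 0) (h + z 1) := by
  rw [vbond, vbond, Sym2.map_mk, Sym2.eq_iff]; left
  refine ⟨?_, ?_⟩
  · rw [site_two_eq_iff]; simp
  · rw [site_two_eq_iff]; simp; ring

/-- ★ The bond between translated neighbours is the translated bond. [cite: EntingJensen2009, §7.4.2, Fig. 7.10] -/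
theorem bond_shiftCell (z : Site 2) {c d : Cell} (hd : d ∈ nbrs c) :
    bond (shiftCell z c) (shiftCell z d) = Sym2.map (fun v => v + z) (bond c d) := by
  obtain ⟨x, y⟩ := c
  simp only [mem_nbrs_iff] at hd
  rcases hd with rfl | rfl | rfl | rfl | rfl | rfl
  · rw [bond_ll, map_hbond, show shiftCell z (x - 1, y - 1) = (x + z 0 - 1, y + z 1 - 1) from Prod.ext (by show x - 1 + z 0 = _; ring) (by show y - 1 + z 1 = _; ring)]
    exact bond_ll _ _
  · rw [bond_lr, map_hbond, show shiftCell z (x + 1, y - 1) = (x + z 0 + 1, y + z 1 - 1) from Prod.ext (by show x + 1 + z 0 = _; ring) (by show y - 1 + z 1 = _; ring),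
      show x + 1 + z 0 = x + z 0 + 1 by ring]
    exact bond_lr _ _
  · rw [bond_r, map_vbond, show shiftCell z (x + 2, y) = (x + z 0 + 2, y + z 1) from Prod.ext (by show x + 2 + z 0 = _; ring) rfl,
      show x + 2 + z 0 = x + z 0 + 2 by ring]
    exact bond_r _ _
  · rw [bond_ur, map_hbond, show shiftCell z (x + 1, y + 1) = (x + z 0 + 1, y + z 1 + 1) from Prod.ext (by show x + 1 + z 0 = _; ring) (by show y + 1 + z 1 = _; ring),
      show x + 1 + z 0 = x + z 0 + 1 by ring, show y + 1 + z 1 = y + z 1 + 1 by ring]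
    exact bond_ur _ _
  · rw [bond_ul, map_hbond, show shiftCell z (x - 1, y + 1) = (x + z 0 - 1, y + z 1 + 1) from Prod.ext (by show x - 1 + z 0 = _; ring) (by show y + 1 + z 1 = _; ring),
      show y + 1 + z 1 = y + z 1 + 1 by ring]
    exact bond_ul _ _
  · rw [bond_l, map_vbond, show shiftCell z (x - 2, y) = (x + z 0 - 2, y + z 1) from Prod.ext (by show x - 2 + z 0 = _; ring) rfl]
    exact bond_l _ _

/-- ★ **The boundary of a translate is the translated boundary.** [cite: MadrasSlade1993, Definition 3.2.2 p. 63 (translation classes of polygons)] -/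
theorem bdry_image_shiftCell (z : Site 2) (S : Finset Cell) : bdry (S.image (shiftCell z)) = shiftEdges z (bdry S) := by
  ext e
  rw [mem_bdry_iff, mem_shiftEdges_iff]
  constructor
  · rintro ⟨c', hc', d', hd', hd'S, rfl⟩
    obtain ⟨c, hc, rfl⟩ := mem_image.1 hc'
    obtain ⟨d, hd, rfl⟩ := mem_image.1 (by rw [← nbrs_shiftCell]; exact hd')
    refine ⟨bond c d, bond_mem_bdry hc hd (fun hdS => hd'S (mem_image_of_mem _ hdS)), (bond_shiftCell z hd).symm⟩
  · rintro ⟨e', he', rfl⟩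
    obtain ⟨c, hc, d, hd, hdS, rfl⟩ := mem_bdry_iff.1 he'
    refine ⟨shiftCell z c, mem_image_of_mem _ hc, shiftCell z d, (shiftCell_mem_nbrs_iff z).2 hd, ?_, bond_shiftCell z hd⟩
    intro h
    obtain ⟨d'', hd'', he⟩ := mem_image.1 h
    exact hdS (shiftCell_injective z he ▸ hd'')

/-- Translation preserves the perimeter. [cite: Jensen2006HoneycombPolygons, §2] -/
theorem perim_image_shiftCell (z : Site 2) (S : Finset Cell) : perim (S.image (shiftCell z)) = perim S := by
  rw [perim, perim, sum_image fun c _ d _ h => shiftCell_injective z h]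
  refine sum_congr rfl fun c _ => ?_
  rw [nbrs_shiftCell, ← image_sdiff _ _ (shiftCell_injective z), card_image_of_injective _ (shiftCell_injective z)]

/-! ### The bottom-left hexagon -/

/-- `b` is the BOTTOM-LEFT hexagon of `S`: minimal for (row, then abscissa) — the order dual to `IsLexmax`.
[cite: MadrasSlade1993, §3.2 (proof of Theorem 3.2.3: lexicographic extremal points of a polygon)] -/
def IsLexmin (S : Finset Cell) (b : Cell) : Prop := b ∈ S ∧ ∀ c ∈ S, b.2 < c.2 ∨ (b.2 = c.2 ∧ b.1 ≤ c.1)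

/-- A nonempty finite set of hexagons has a bottom-left hexagon. [cite: MadrasSlade1993, §3.2 (proof of Theorem 3.2.3)] -/
theorem exists_isLexmin {S : Finset Cell} (hS : S.Nonempty) : ∃ b, IsLexmin S b := by
  -- reflect through the origin and use `exists_isLexmax`
  have hne : (S.image fun c : Cell => ((-c.1, -c.2) : Cell)).Nonempty := hS.image _
  obtain ⟨t, ht, hmax⟩ := exists_isLexmax hne
  obtain ⟨b, hb, rfl⟩ := mem_image.1 ht
  refine ⟨b, hb, fun c hc => ?_⟩
  have := hmax _ (mem_image_of_mem _ hc)
  simp only at this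
  omega

/-- The bottom-left hexagon is unique. [cite: MadrasSlade1993, §3.2 (proof of Theorem 3.2.3)] -/
theorem IsLexmin.unique {S : Finset Cell} {b b' : Cell} (h : IsLexmin S b) (h' : IsLexmin S b') : b = b' := by
  have h1 := h.2 b' h'.1
  have h2 := h'.2 b h.1
  ext <;> omega

/-- Nothing of `S` lies below the bottom row. [cite: MadrasSlade1993, §3.2 (proof of Theorem 3.2.3)] -/
theorem IsLexmin.notMem_of_row_lt {S : Finset Cell} {b c : Cell} (h : IsLexmin S b) (hc : c.2 < b.2) : c ∉ S := by
  intro hcS; have := h.2 c hcS; omega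

/-- Nothing of `S` lies left of `b` on the bottom row. [cite: MadrasSlade1993, §3.2 (proof of Theorem 3.2.3)] -/
theorem IsLexmin.notMem_of_left {S : Finset Cell} {b c : Cell} (h : IsLexmin S b) (hr : c.2 = b.2) (hx : c.1 < b.1) : c ∉ S := by
  intro hcS; have := h.2 c hcS; omega

/-- In particular `LL b`, `LR b`, `L b ∉ S`. [cite: MadrasSlade1993, §3.2 (proof of Theorem 3.2.3)] -/
theorem IsLexmin.ll_notMem {S : Finset Cell} {b : Cell} (h : IsLexmin S b) : LL b ∉ S :=
  h.notMem_of_row_lt (by simp)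

/-- [cite: MadrasSlade1993, §3.2 (proof of Theorem 3.2.3)] -/
theorem IsLexmin.lr_notMem {S : Finset Cell} {b : Cell} (h : IsLexmin S b) : LR b ∉ S :=
  h.notMem_of_row_lt (by simp)

/-- [cite: MadrasSlade1993, §3.2 (proof of Theorem 3.2.3)] -/
theorem IsLexmin.l_notMem {S : Finset Cell} {b : Cell} (h : IsLexmin S b) : L b ∉ S :=
  h.notMem_of_left (by simp) (by simp)

/-- Translation carries the bottom-left hexagon along. [cite: MadrasSlade1993, Definition 3.2.2 p. 63] -/
theorem isLexmin_image_shiftCell (z : Site 2) {S : Finset Cell} {b : Cell} (h : IsLexmin S b) :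
    IsLexmin (S.image (shiftCell z)) (shiftCell z b) := by
  refine ⟨mem_image_of_mem _ h.1, fun c hc => ?_⟩
  obtain ⟨d, hd, rfl⟩ := mem_image.1 hc
  have := h.2 d hd
  simp only [shiftCell_fst, shiftCell_snd]
  omega

/-- Translation carries the top hexagon along. [cite: MadrasSlade1993, Definition 3.2.2 p. 63] -/
theorem isLexmax_image_shiftCell (z : Site 2) {S : Finset Cell} {t : Cell} (h : IsLexmax S t) :
    IsLexmax (S.image (shiftCell z)) (shiftCell z t) := by
  refine ⟨mem_image_of_mem _ h.1, fun c hc => ?_⟩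
  obtain ⟨d, hd, rfl⟩ := mem_image.1 hc
  have := h.2 d hd
  simp only [shiftCell_fst, shiftCell_snd]
  omega

/-- **Normalisation**: translating by minus the bottom-left hexagon puts the bottom-left hexagon at the origin; the translation vector is even when
`S` is a brick set. [cite: MadrasSlade1993, Definition 3.2.2 p. 63 (one representative per translation class)] -/
theorem isLexmin_normalize {S : Finset Cell} {b : Cell} (h : IsLexmin S b) :
    IsLexmin (S.image (shiftCell ![-b.1, -b.2])) (0, 0) := by
  have := isLexmin_image_shiftCell ![-b.1, -b.2] h
  rwa [show shiftCell ![-b.1, -b.2] b = (0, 0) by ext <;> simp] at this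

end HexCell

end Literature.Probability.RandomPlanarGeometry.SAW
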